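import Literature.MathematicalPhysics.QuantumFieldTheory.Balaban1983to89.B9Thm37KLetterDir
import Literature.MathematicalPhysics.QuantumFieldTheory.Balaban1983to89.B9RWSums347DefiniteFaces

/-!
# `Balaban1983to89.B9Cor38WholeDir` — Corollary 3.8's pinned expansion datum and leaf OVER THE DIRECTION LETTERS (ruling R1′): n06-c∕n06-k's
# `B9Cor38Whole.{Locality, walkOps, W38OfOps, locDep_W38OfOps, term_W38OfOps_le, cor38Printed_of_local342, thm37Printed_W38OfOps_of_local342}` and
# `B9RWSums347DefiniteFaces.{thm37_cor38_W38OfOps_exp261_of_rowSum261, thm37_cor38_W38OfOps_exp261_geo9Y}` with K-letter `KopDir`, `h36 ∋ DirSupSq37 ∧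
# Identities₂` — engine re-thread (A5∕A6), file 7

T. Bałaban, *Propagators for lattice gauge theories in a background field*, Commun. Math. Phys. **99** (1985) 389–434
[`Balaban1985BackgroundPropagators`, "B9"], Thm 3.7 (3.90) p. 409, Cor. 3.8 (3.91)–(3.94) p. 410, (3.89) p. 409, Cor. 3.6 p. 408, (3.39) p. 397; T. Bałaban,
*Propagators and renormalization transformations for lattice gauge theories. II*, Commun. Math. Phys. **96** (1984) 223–250 [`Balaban1984PropagatorsII`, "[4]"],
Lemma 2.1 (2.59)–(2.61) pp. 233–234, (2.40)–(2.44) p. 230.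

statement-level skeleton of published theorems with citation tags; proofs where landed; nothing here is a claim about the
Yang–Mills mass gap

WHY THIS FILE (cell `pub-ymgap`, Track A node N06 [B9], rows 13∕18; dag-n06-d g10 «re-thread the engine over Identities₂»; seat `pub-ymgap-dag-n06-c` g10).
The pinned walk datum `W38OfOps` writes its factors K(h_□)G′_□h_□ with the v1 K-letter `𝔬.P U □ ∘ₗ 𝔬.D U + 𝔬.Cop U □`, and its (3.94) bound reads the letter majorants
`Identities.hP ∕ hC`.  Over def-Y's per-direction letters the factor is `KopDir 𝔬 𝔡 𝔩 U □ · G′_□ · M_h` (`walkOpsDir`, datum `W38OfOpsDir`), its majorant is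
`B9Thm37KLetterDir.h389_dir` (Cor. 3.6 entries + `DirSupSq37` + `Identities₂`), knit by `B9Thm37Sum.cor38_walk_majorant` exactly as v1; locality hypothesis
`LocalityDir`; the record-level faces follow with `h36 ∋ Local342 ∧ DirSupSq37 ∧ Identities₂`.  Constants, quantifier witnesses and every other input VERBATIM v1.

HONEST SCOPE.  Bookkeeping; Corollary 3.6's blocks, the letters' structure and the locality inputs are HYPOTHESES (schemas); nothing of [B9] asserted; COUNT-NEUTRAL;
N06 NOT discharged; one finite lattice programme — nothing continuum, nothing about OS positivity or the mass gap.
-/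

namespace Literature.MathematicalPhysics.QuantumFieldTheory.Balaban1983to89.B9Cor38WholeDir

open Finset B6RandomWalk B6RandomWalkHom B9Thm37Sum B9Thm34Ext B9Thm37Glue B9Thm37Whole B9Cor38Whole B9Thm310Whole
open B9RowSum261Faces B9RowSum261DefiniteFaces B9Ineq349Whole B9RWSums343to347Whole B9PinMembersKLevelV1 B9GeoLemma21KLevelV1 B9RWSums347DefiniteFaces
open B9RWSums346SecondDiff B9RWSums346SecondDiffGp B9Thm37WholeDir B9Thm37GlueDir B9Thm37KLetterDir

noncomputable section

/-! ## §1 One member: the locality schema, the walk factors, the pinned datum, the U-localisation clause and the bound (3.94) -/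

section OneMember

variable {g : B9.Geometry} [Fintype g.Site] [DecidableEq g.Site] {B : B9.Backgrounds} {X Y ι Dir : Type} [Fintype Dir]

/-- **v2 of `B9Cor38Whole.Locality` OVER THE DIRECTION LETTERS** (`K(h_□) = KopDir 𝔬 𝔡 𝔩 U □ = Σ_μ P_{□,μ}∇_{U,μ} + C_□`). **THE TWO PRINTED LOCALITY INPUTS** (p. 410, verbatim: *"A propagator G′_□ depends on U restricted to Ω₀(□) ⊂ □̃⁵,
and the operator K(h) is semi-local"*), as a hypothesis schema on the letters: the factors h_□G′_□(U)h_□ and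
K(h_□)G′_□(U)h_□ = (P_□∇_U + C_□)G′_□(U)h_□ of (3.90) coincide at configurations coinciding on □̃⁵ (`Agree □`).
Nothing asserted. [cite: Balaban1985BackgroundPropagators, Cor. 3.8 p.410] -/
structure LocalityDir (𝔬 : Ops g B X Y ι) (𝔡 : DirOps37 𝔬 Dir) (𝔩 : DirLetters37 𝔬 Dir) (rd : WalkReading g B X ι) : Prop where
  gsq : ∀ (q : ι) (U U' : B.Cfg), rd.Agree q U U' →
    mulOp (𝔬.h q) * 𝔬.Gsq U q * mulOp (𝔬.h q) = mulOp (𝔬.h q) * 𝔬.Gsq U' q * mulOp (𝔬.h q)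
  kgh : ∀ (q : ι) (U U' : B.Cfg), rd.Agree q U U' →
    KopDir 𝔬 𝔡 𝔩 U q * 𝔬.Gsq U q * mulOp (𝔬.h q) = KopDir 𝔬 𝔡 𝔩 U' q * 𝔬.Gsq U' q * mulOp (𝔬.h q)

omit [Fintype g.Site] [DecidableEq g.Site] in
/-- A nonnegative pointwise bound on the block bounds the block sup (`Real.iSup_le`). [folklore] -/
private theorem blkSup_le' (blk : X → g.Site) {f : X → ℝ} {y : g.Site} {c : ℝ} (hc : 0 ≤ c)
    (h : ∀ x, blk x = y → f x ≤ c) : blkSup blk f y ≤ c :=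
  Real.iSup_le (fun x => h x.1 x.2) hc

omit [Fintype g.Site] [DecidableEq g.Site] [Fintype Dir] in
/-- **(v2, K-letter `KopDir`.) The factors of the term of (3.90) indexed by ω = (□₀, □₁, …)** at U: F₀ = h_{□₀}G′_{□₀}(U)h_{□₀},
Fᵢ = K(h_{□ᵢ})G′_{□ᵢ}(U)h_{□ᵢ} = (P_{□ᵢ}∇_U + C_{□ᵢ})G′_{□ᵢ}(U)h_{□ᵢ} (i ≧ 1); the term is `B9Thm37Sum.lprod` of these.
[cite: Balaban1985BackgroundPropagators, (3.90) p.409] -/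
def walkOpsDir (𝔬 : Ops g B X Y ι) (𝔡 : DirOps37 𝔬 Dir) (𝔩 : DirLetters37 𝔬 Dir) (U : B.Cfg) (ω : ℕ → ι) (k : ℕ) :
    Module.End ℝ (X → ℝ) :=
  if k = 0 then mulOp (𝔬.h (ω 0)) * 𝔬.Gsq U (ω 0) * mulOp (𝔬.h (ω 0))
  else KopDir 𝔬 𝔡 𝔩 U (ω k) * 𝔬.Gsq U (ω k) * mulOp (𝔬.h (ω k))

omit [Fintype g.Site] [DecidableEq g.Site] in
/-- Left-nested products only read their first n + 1 factors: equal factors give equal products. [folklore] -/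
private theorem lprod_congr' {F F' : ℕ → Module.End ℝ (X → ℝ)} :
    ∀ (n : ℕ), (∀ k, k ≤ n → F k = F' k) → lprod F n = lprod F' n := by
  intro n
  induction n generalizing F F' with
  | zero => intro h; exact h 0 le_rfl
  | succ n ih =>
      intro h
      show F 0 * lprod (fun i => F (i + 1)) n = F' 0 * lprod (fun i => F' (i + 1)) n
      rw [h 0 (Nat.zero_le _), ih (fun k hk => h (k + 1) (by omega))]

/-- ★ **(v2 OVER THE DIRECTION LETTERS: `B9Cor38Whole.W38OfOps` with the walk factors `walkOpsDir`, K-letter `KopDir`.) THE EXPANSION DATUM OF THEOREM 3.7 ∕ COROLLARY 3.8 WITH EVERY FIELD PINNED.**  `Walk` = pairs (n, ω) reading the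
walk (□₀, …, □ₙ) = (ω 0, …, ω n); `wlen` = |ω| = n; `first (n, ω) y` = y ∈ S_{□₀} (print: y ∈ □₀ ∩ Λ_j); `last (n, ω) y′`
= y′ ∈ S′_{□ₙ} (print: y′ ∈ □ₙ); `wdist` = d(ω, y, y′) of (3.93) (`minLen` over S′_{□₁}, …, S′_{□ₙ}); `term U (n, ω) λ y`
= |Δ(y)h_{□₀}G′_{□₀}h_{□₀}Π_{i=1}^nK(h_{□ᵢ})G′_{□ᵢ}h_{□ᵢ}λ| read as the block sup of the lattice function
(`lprod (walkOpsDir 𝔬 𝔡 𝔩 U ω) n`) applied to `ev λ`; `LocDep U (n, ω)` = «the term operator at U equals the one at every U′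
coinciding with U on □̃⁵₀ ∪ … ∪ □̃⁵ₙ»; `Converges U` = `B9Thm37Whole.Conv342 𝔬 R H C δ U` (so that
`E37OfOps (W38OfOpsDir …) … = W38OfOpsDir …`, `E37OfOps_W38OfOpsDir`).
[cite: Balaban1985BackgroundPropagators, Thm 3.7 (3.90) p.409 + Cor. 3.8 (3.93)–(3.94) p.410] -/
def W38OfOpsDir (𝔬 : Ops g B X Y ι) (𝔡 : DirOps37 𝔬 Dir) (𝔩 : DirLetters37 𝔬 Dir) (rd : WalkReading g B X ι) (R : ℝ) (H : Prop) (C δ : ℝ) :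
    B9.RWExpansion g B where
  Walk := ℕ × (ℕ → ι)
  wlen w := w.1
  first w y := y ∈ 𝔬.S (w.2 0)
  last w y' := y' ∈ 𝔬.S' (w.2 w.1)
  wdist w y y' := minLen g.dist (walkSets 𝔬 w.2) w.1 y y'
  term U w lam y := blkSup 𝔬.blk (fun x => |lprod (walkOpsDir 𝔬 𝔡 𝔩 U w.2) w.1 (rd.ev lam) x|) y
  LocDep U w := ∀ U' : B.Cfg, (∀ k, k ≤ w.1 → rd.Agree (w.2 k) U U') →
    lprod (walkOpsDir 𝔬 𝔡 𝔩 U w.2) w.1 = lprod (walkOpsDir 𝔬 𝔡 𝔩 U' w.2) w.1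
  Converges U := Conv342 𝔬 R H C δ U

omit [DecidableEq g.Site] in
/-- Pinning the convergence predicate of `W38OfOpsDir` changes nothing: `B9Thm37Whole.E37OfOps (W38OfOpsDir …) … = W38OfOpsDir …`
(by `rfl`) — the Theorem 3.7 results of `B9Thm37Whole` apply verbatim at this datum.
[cite: Balaban1985BackgroundPropagators, Thm 3.7 p.409] -/
theorem E37OfOps_W38OfOpsDir (𝔬 : Ops g B X Y ι) (𝔡 : DirOps37 𝔬 Dir) (𝔩 : DirLetters37 𝔬 Dir) (rd : WalkReading g B X ι) (R : ℝ)
    (H : Prop) (C δ : ℝ) : E37OfOps (W38OfOpsDir 𝔬 𝔡 𝔩 rd R H C δ) 𝔬 R H C δ = W38OfOpsDir 𝔬 𝔡 𝔩 rd R H C δ :=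
  rfl

omit [DecidableEq g.Site] in
/-- **The U-localisation clause of Corollary 3.8** (*"The term in the expansion (3.90) corresponding to a walk
ω = (□₀, □₁, …, □ₙ) depends on U restricted to □̃⁵₀ ∪ □̃⁵₁ ∪ … ∪ □̃⁵ₙ"*) at `W38OfOpsDir`, from the two printed locality
inputs (`LocalityDir`): p. 410, *"A propagator G′_□ depends on U restricted to Ω₀(□) ⊂ □̃⁵, and the operator K(h) is
semi-local, hence …"*. [cite: Balaban1985BackgroundPropagators, Cor. 3.8 p.410] -/
theorem locDep_W38OfOpsDir (𝔬 : Ops g B X Y ι) (𝔡 : DirOps37 𝔬 Dir) (𝔩 : DirLetters37 𝔬 Dir) (rd : WalkReading g B X ι) (R : ℝ)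
    (H : Prop) (C δ : ℝ) (hloc : LocalityDir 𝔬 𝔡 𝔩 rd) (U : B.Cfg) (w : ℕ × (ℕ → ι)) :
    (W38OfOpsDir 𝔬 𝔡 𝔩 rd R H C δ).LocDep U w := by
  intro U' hU'
  refine lprod_congr' w.1 fun k hk => ?_
  by_cases hk0 : k = 0
  · subst hk0
    simp only [walkOpsDir, if_true]
    exact hloc.gsq (w.2 0) U U' (hU' 0 (Nat.zero_le _))
  · simp only [walkOpsDir, hk0, if_false]
    exact hloc.kgh (w.2 k) U U' (hU' k hk)

/-- **(v2 OVER THE DIRECTION LETTERS — `B9Cor38Whole.term_W38OfOps_le` with the factor majorants from `h389_dir` (`DirSupSq37`, `Identities₂`).) THE BOUND (3.94) at one member and one configuration U** (p. 410: *"|Δ(y)h_{□₀}G′_{□₀}h_{□₀}Π_{i=1}^n K(h_{□ᵢ})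
G′_{□ᵢ}h_{□ᵢ}Δ(y′)λ| ≦ O(1)(L^jη)²O(M^{−1/2})^{|ω|}M^{−1/2|ω|}e^{−(1/2)δ₀d(ω,y,y′)}|Δ(y′)λ| for y ∈ □₀ ∩ Λ_j"*) at the
datum `W38OfOpsDir`, with O(1) = B₀, O(M^{−1/2}) = (B₀e^{δ₀ρ}θ₀c₁(α) + 1)M^{−1/2} and ½δ₀′, δ₀′ = 2(1 − α)δ₀: from
Corollary 3.6 entries 1, 2 for the G′_□(U) (`Local342`), the majorants of the letters of K(h_□) (`Identities`), the
static data, the K(h_□) sizes ≦ θ₀M⁻¹ (the O(M⁻¹) of (3.89)), (2.61) at α and the reading clauses — by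
`B9Thm37Sum.cor38_walk_majorant` + `B9Thm37KLetterDir.h389_dir` ((3.91)–(3.92)), `LB_minLen` ((3.93)) and `B9.split_small_factor`.
[cite: Balaban1985BackgroundPropagators, Cor. 3.8 (3.91)–(3.94) p.410 + (3.89) p.409; Balaban1984PropagatorsII, Lemma 2.1 (2.61) p.234] -/
theorem term_W38OfOpsDir_le [Fintype X] [DecidableEq X] [Fintype Y] [Fintype ι] (𝔬 : Ops g B X Y ι) (𝔡 : DirOps37 𝔬 Dir)
    (𝔩 : DirLetters37 𝔬 Dir) (rd : WalkReading g B X ι) (R : ℝ) (H : Prop) (C δ : ℝ) (d : ℕ) (δ₀ α ρ B₀ N N' Cℓ θ₀ : ℝ) (κ : Sizes) (U : B.Cfg)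
    (hB₀ : 0 ≤ B₀) (hδ₀ : 0 ≤ δ₀) (hα : 0 ≤ α) (hα1 : α ≤ 1) (hθ₀ : 0 ≤ θ₀) (hM : 0 < g.M)
    (hs : StaticOK 𝔬 ρ N N' Cℓ κ) (hκ : κ.Nonneg) (hrow : κ.kP + κ.kC ≤ θ₀ * g.M⁻¹)
    (h261 : Ineq261 d (toB6 g R H) δ₀ α) (hrd : rd.OK 𝔬.blk) (hl : Local342 𝔬 R H B₀ δ₀ U)
    (hT : DirSupSq37 𝔬 𝔡 R H U) (hi : Identities₂ 𝔬 𝔡 𝔩 R H U) (w : ℕ × (ℕ → ι)) (lam : g.Loc) (y y' : g.Site) (hy : y ∈ 𝔬.S (w.2 0))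
    (hlam : g.suppIn lam y') :
    (W38OfOpsDir 𝔬 𝔡 𝔩 rd R H C δ).term U w lam y ≤
      g.len y ^ 2 * B9.walkFactor B₀ (B₀ * Real.exp (δ₀ * ρ) * θ₀ * B6.c1 d δ₀ α + 1) g.M (2 * ((1 - α) * δ₀))
        ((W38OfOpsDir 𝔬 𝔡 𝔩 rd R H C δ).wlen w) ((W38OfOpsDir 𝔬 𝔡 𝔩 rd R H C δ).wdist w y y') * g.supNorm lam := by
  obtain ⟨n, ω⟩ := w
  have hlen : ∀ z : g.Site, 0 ≤ g.len z := fun z => (hs.lenpos z).le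
  have htri : Triangle254 (toB6 g R H) := fun a b c => hs.tri a b c
  have hk12 : 0 ≤ κ.kP + κ.kC := add_nonneg hκ.kP hκ.kC
  have hαδ : 0 ≤ α * δ₀ := mul_nonneg hα hδ₀
  have h1αδ : 0 ≤ (1 - α) * δ₀ := mul_nonneg (by linarith) hδ₀
  have hc1 : 0 ≤ B6.c1 d δ₀ α := c1_nonneg d δ₀ α
  have hθ : 0 ≤ B₀ * Real.exp (δ₀ * ρ) * (κ.kP + κ.kC) := mul_nonneg (mul_nonneg hB₀ (Real.exp_nonneg _)) hk12
  have hc0 : 0 ≤ B₀ * Real.exp (δ₀ * ρ) * θ₀ * B6.c1 d δ₀ α :=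
    mul_nonneg (mul_nonneg (mul_nonneg hB₀ (Real.exp_nonneg _)) hθ₀) hc1
  have hcpos : 0 < B₀ * Real.exp (δ₀ * ρ) * θ₀ * B6.c1 d δ₀ α + 1 := by linarith
  -- (3.91)–(3.92): the term has the majorant 1_{S_{□₀}}(y)B₀(L^jη)²(θc₁)ⁿe^{−(1−α)δ₀dω}
  --   first factor h_{□₀}G′_{□₀}h_{□₀} by the sandwich of (3.42)₁; the factors K(h_{□ᵢ})G′_{□ᵢ}h_{□ᵢ} (i ≧ 1) by `h389_dir`
  --   (Cor. 3.6 entries, `DirSupSq37`, `Identities₂`); knit by `B9Thm37Sum.cor38_walk_majorant` with d_ω = `minLen` (`LB_minLen`)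
  have hT0 : HasMajorant (g := toB6 g R H) 𝔬.blk (walkOpsDir 𝔬 𝔡 𝔩 U ω 0)
      (fun (a b : g.Site) => if a ∈ walkSets 𝔬 ω 0 then B₀ * g.len a ^ 2 * Real.exp (-(δ₀ * g.dist a b)) else 0) := by
    simp only [walkOpsDir, walkSets, if_true]
    exact hasMajorant_sandwich_local (R := R) (H := H) 𝔬.blk (hl.e0 (ω 0)) (𝔬.h (ω 0)) (hs.hh (ω 0)) (𝔬.S (ω 0))
      (hs.hS (ω 0))
  have h389 := h389_dir (R := R) (H := H) (κ := κ) hB₀ hδ₀ hs hl hT hi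
  have hRk : ∀ k, 1 ≤ k → k ≤ n → HasMajorant (g := toB6 g R H) 𝔬.blk (walkOpsDir 𝔬 𝔡 𝔩 U ω k)
      (fun (a b : g.Site) => if a ∈ walkSets 𝔬 ω k then
        B₀ * Real.exp (δ₀ * ρ) * (κ.kP + κ.kC) * Real.exp (-(δ₀ * g.dist a b)) else 0) := by
    intro k hk _
    have hk0 : k ≠ 0 := by omega
    simp only [walkOpsDir, walkSets, hk0, if_false]
    exact h389 (ω k)
  have hmaj' := cor38_walk_majorant (R := R) (H := H) 𝔬.blk d δ₀ α (B₀ * Real.exp (δ₀ * ρ) * (κ.kP + κ.kC)) B₀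
    (walkSets 𝔬 ω) (walkOpsDir 𝔬 𝔡 𝔩 U ω) (minLen g.dist (walkSets 𝔬 ω) n) n hB₀ hθ hs.dnn hαδ h1αδ h261 hT0 hRk
    (fun a b => LB_minLen g.dist n (walkSets 𝔬 ω) a b)
  have hmaj : HasMajorant (g := toB6 g R H) 𝔬.blk (lprod (walkOpsDir 𝔬 𝔡 𝔩 U ω) n)
      (fun (a b : g.Site) => (if a ∈ 𝔬.S (ω 0) then B₀ * g.len a ^ 2 else 0) *
        (B₀ * Real.exp (δ₀ * ρ) * (κ.kP + κ.kC) * B6.c1 d δ₀ α) ^ n *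
          Real.exp (-((1 - α) * δ₀ * minLen g.dist (walkSets 𝔬 ω) n a b))) := by
    refine hasMajorant_mono (g := toB6 g R H) 𝔬.blk hmaj' fun a b => le_of_eq ?_
    simp only [walkSets, if_true]
  -- evaluate at the argument λ: supp λ ⊂ Δ(y′), |ev λ| ≦ |λ|
  have hμ : BlockSupp (g := toB6 g R H) 𝔬.blk (rd.ev lam) y' (g.supNorm lam) :=
    ⟨hrd.norm_nonneg lam, fun x _ => hrd.bound lam x, hrd.off lam y' hlam⟩
  have hpt : ∀ x, 𝔬.blk x = y → |lprod (walkOpsDir 𝔬 𝔡 𝔩 U ω) n (rd.ev lam) x| ≤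
      B₀ * g.len y ^ 2 * ((B₀ * Real.exp (δ₀ * ρ) * (κ.kP + κ.kC)) * B6.c1 d δ₀ α) ^ n *
        Real.exp (-((1 - α) * δ₀ * (minLen g.dist (walkSets 𝔬 ω) n y y'))) * g.supNorm lam := by
    intro x hx
    have h := hmaj y' (rd.ev lam) (g.supNorm lam) hμ x
    rw [hx] at h
    refine h.trans (le_of_eq ?_)
    simp only [if_pos hy]
  -- (θc₁)ⁿ ≦ (cM⁻¹)ⁿ = (cM^{−1/2})ⁿM^{−n/2}, θ = B₀e^{δ₀ρ}(k_P + k_C), c = B₀e^{δ₀ρ}θ₀c₁ + 1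
  have hθc : (B₀ * Real.exp (δ₀ * ρ) * (κ.kP + κ.kC)) * B6.c1 d δ₀ α ≤ (B₀ * Real.exp (δ₀ * ρ) * θ₀ * B6.c1 d δ₀ α + 1) * g.M⁻¹ := by
    have hMinv : 0 ≤ g.M⁻¹ := inv_nonneg.mpr hM.le
    have h1 : (B₀ * Real.exp (δ₀ * ρ) * (κ.kP + κ.kC)) ≤ B₀ * Real.exp (δ₀ * ρ) * (θ₀ * g.M⁻¹) :=
      mul_le_mul_of_nonneg_left hrow (mul_nonneg hB₀ (Real.exp_nonneg _))
    calc (B₀ * Real.exp (δ₀ * ρ) * (κ.kP + κ.kC)) * B6.c1 d δ₀ α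
        ≤ B₀ * Real.exp (δ₀ * ρ) * (θ₀ * g.M⁻¹) * B6.c1 d δ₀ α := mul_le_mul_of_nonneg_right h1 hc1
      _ = (B₀ * Real.exp (δ₀ * ρ) * θ₀ * B6.c1 d δ₀ α) * g.M⁻¹ := by ring
      _ ≤ (B₀ * Real.exp (δ₀ * ρ) * θ₀ * B6.c1 d δ₀ α + 1) * g.M⁻¹ := mul_le_mul_of_nonneg_right (by linarith) hMinv
  have hpow : ((B₀ * Real.exp (δ₀ * ρ) * (κ.kP + κ.kC)) * B6.c1 d δ₀ α) ^ n ≤ ((B₀ * Real.exp (δ₀ * ρ) * θ₀ * B6.c1 d δ₀ α + 1) * g.M⁻¹) ^ n :=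
    pow_le_pow_left₀ (mul_nonneg hθ hc1) hθc n
  have hexp : Real.exp (-((1 - α) * δ₀ * (minLen g.dist (walkSets 𝔬 ω) n y y'))) =
      Real.exp (-(2 * ((1 - α) * δ₀) / 2 * (minLen g.dist (walkSets 𝔬 ω) n y y'))) := by
    congr 1; ring
  have hfac : B₀ * g.len y ^ 2 * ((B₀ * Real.exp (δ₀ * ρ) * (κ.kP + κ.kC)) * B6.c1 d δ₀ α) ^ n *
        Real.exp (-((1 - α) * δ₀ * (minLen g.dist (walkSets 𝔬 ω) n y y'))) ≤
      g.len y ^ 2 * B9.walkFactor B₀ (B₀ * Real.exp (δ₀ * ρ) * θ₀ * B6.c1 d δ₀ α + 1) g.M (2 * ((1 - α) * δ₀)) n (minLen g.dist (walkSets 𝔬 ω) n y y') := by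
    calc B₀ * g.len y ^ 2 * ((B₀ * Real.exp (δ₀ * ρ) * (κ.kP + κ.kC)) * B6.c1 d δ₀ α) ^ n *
          Real.exp (-((1 - α) * δ₀ * (minLen g.dist (walkSets 𝔬 ω) n y y')))
        ≤ B₀ * g.len y ^ 2 * ((B₀ * Real.exp (δ₀ * ρ) * θ₀ * B6.c1 d δ₀ α + 1) * g.M⁻¹) ^ n *
            Real.exp (-((1 - α) * δ₀ * (minLen g.dist (walkSets 𝔬 ω) n y y'))) :=
          mul_le_mul_of_nonneg_right (mul_le_mul_of_nonneg_left hpow (mul_nonneg hB₀ (sq_nonneg _)))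
            (Real.exp_nonneg _)
      _ = g.len y ^ 2 * B9.walkFactor B₀ (B₀ * Real.exp (δ₀ * ρ) * θ₀ * B6.c1 d δ₀ α + 1) g.M (2 * ((1 - α) * δ₀)) n (minLen g.dist (walkSets 𝔬 ω) n y y') := by
          rw [B9.split_small_factor (B₀ * Real.exp (δ₀ * ρ) * θ₀ * B6.c1 d δ₀ α + 1) g.M hM n, hexp]
          simp only [B9.walkFactor]
          ring
  -- assemble: the block sup is below the (nonnegative) common bound
  have hrhs : 0 ≤ g.len y ^ 2 * B9.walkFactor B₀ (B₀ * Real.exp (δ₀ * ρ) * θ₀ * B6.c1 d δ₀ α + 1) g.M (2 * ((1 - α) * δ₀)) n (minLen g.dist (walkSets 𝔬 ω) n y y') *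
      g.supNorm lam := by
    refine mul_nonneg (mul_nonneg (sq_nonneg _) ?_) (hrd.norm_nonneg lam)
    simp only [B9.walkFactor]
    exact mul_nonneg (mul_nonneg (mul_nonneg hB₀ (pow_nonneg (mul_nonneg hcpos.le
      (Real.rpow_nonneg hM.le _)) _)) (Real.rpow_nonneg hM.le _)) (Real.exp_nonneg _)
  show blkSup 𝔬.blk (fun x => |lprod (walkOpsDir 𝔬 𝔡 𝔩 U ω) n (rd.ev lam) x|) y ≤
    g.len y ^ 2 * B9.walkFactor B₀ (B₀ * Real.exp (δ₀ * ρ) * θ₀ * B6.c1 d δ₀ α + 1) g.M (2 * ((1 - α) * δ₀)) n (minLen g.dist (walkSets 𝔬 ω) n y y') * g.supNorm lam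
  refine blkSup_le' 𝔬.blk hrhs fun x hx => (hpt x hx).trans ?_
  exact mul_le_mul_of_nonneg_right hfac (hrd.norm_nonneg lam)

end OneMember

/-! ## §2 The family: Corollary 3.8 and Theorem 3.7 as the whole printed leaves at `W38OfOpsDir` -/

section Family

variable {I : Type} {c35 : ℝ} {geo : I → B9.Geometry} {bg : I → B9.Backgrounds}
variable [∀ i, Fintype (geo i).Site] [∀ i, DecidableEq (geo i).Site]
variable {X Y ι Dir : I → Type} [∀ i, Fintype (X i)] [∀ i, DecidableEq (X i)] [∀ i, Fintype (Y i)]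
  [∀ i, DecidableEq (Y i)] [∀ i, Fintype (ι i)] [∀ i, Fintype (Dir i)]

omit [∀ i, DecidableEq (Y i)] in
/-- ★ **(v2 OVER THE DIRECTION LETTERS: `h36 ∋ DirSupSq37 ∧ Identities₂`, datum `W38OfOpsDir`, locality `LocalityDir`.) COROLLARY 3.8 AS THE WHOLE PRINTED LEAF `B9.Cor38Printed`** (p. 410: *"The term in the expansion (3.90)
corresponding to a walk ω = (□₀, □₁, …, □ₙ) depends on U restricted to □̃⁵₀ ∪ □̃⁵₁ ∪ … ∪ □̃⁵ₙ, and |Δ(y)h_{□₀}G′_{□₀}h_{□₀}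
Π_{i=1}^n K(h_{□ᵢ})G′_{□ᵢ}h_{□ᵢ}Δ(y′)λ| ≦ O(1)(L^jη)²O(M^{−1/2})^{|ω|}M^{−1/2|ω|}e^{−(1/2)δ₀d(ω,y,y′)}|Δ(y′)λ| (3.94) for
y ∈ □₀ ∩ Λ_j, y′ ∈ □ₙ"*), INHABITED at the pinned datum `W38OfOpsDir (𝔬 i) (𝔡 i) (𝔩 i) (rd i) (R i) (H i) C δ` — from, per member
and per U under the provisos of Corollary 3.6 (M ≧ M₁, 0 < α₀, O(1)Mα₀ ≦ a₁, (3.35)): Corollary 3.6 for the G′_□(U)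
(`Local342`), the per-direction entries (`DirSupSq37`) and the letters of the expansion (`Identities₂`); per member: the static data (`StaticOK`), the sizes
(`Sizes.Bounded`: K(h_□) sizes ≦ θ₀M⁻¹), (2.61) at α for M ≧ M_L, the reading clauses (`WalkReading.OK`) and the two
printed locality inputs (`LocalityDir`).  Quantifiers met with M₂ := max(M₁, M_L), a₀ := a₁∕O(1), δ₀′ := 2(1 − α)δ₀,
O(1) := B₀, c := B₀e^{δ₀ρ}θ₀c₁(α) + 1.  Nothing of print asserted; the sup entry (3.94) only (*"Similar estimates hold
for the other norms"* = `B9Thm37AllNorms.cor38_left`, not pinned here); NOT a node discharge.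
[cite: Balaban1985BackgroundPropagators, Cor. 3.8 (3.93)–(3.94) p.410 + Cor. 3.6 p.408; Balaban1984PropagatorsII, Lemma 2.1 (2.61) p.234] -/
theorem cor38Printed_of_local342₂ (𝔬 : ∀ i, Ops (geo i) (bg i) (X i) (Y i) (ι i)) (𝔡 : ∀ i, DirOps37 (𝔬 i) (Dir i))
    (𝔩 : ∀ i, DirLetters37 (𝔬 i) (Dir i))
    (rd : ∀ i, WalkReading (geo i) (bg i) (X i) (ι i)) (R : I → ℝ) (H : I → Prop) (κ : I → Sizes) (C δ : ℝ)
    (d : ℕ) (α ρ N N' Cℓ K θ₀ B₀ δ₀ a₁ M₁ ML : ℝ)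
    (hc : 0 < c35) (hα : 0 ≤ α) (hα1 : α < 1) (hθ₀ : 0 ≤ θ₀) (hB₀ : 0 < B₀) (hδ₀ : 0 < δ₀) (ha₁ : 0 < a₁)
    (hM₁ : 0 < M₁)
    (hst : ∀ i, StaticOK (𝔬 i) ρ N N' Cℓ (κ i)) (hκ : ∀ i, (κ i).Bounded K θ₀ Cℓ (geo i).M)
    (hrd : ∀ i, (rd i).OK (𝔬 i).blk) (hloc : ∀ i, LocalityDir (𝔬 i) (𝔡 i) (𝔩 i) (rd i))
    (h261 : ∀ i, ML ≤ (geo i).M → Ineq261 d (toB6 (geo i) (R i) (H i)) δ₀ α)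
    (h36 : ∀ i, M₁ ≤ (geo i).M → ∀ α₀ : ℝ, 0 < α₀ → c35 * (geo i).M * α₀ ≤ a₁ →
      ∀ U : (bg i).Cfg, (bg i).Reg335 c35 α₀ U →
        Local342 (𝔬 i) (R i) (H i) B₀ δ₀ U ∧ DirSupSq37 (𝔬 i) (𝔡 i) (R i) (H i) U ∧ Identities₂ (𝔬 i) (𝔡 i) (𝔩 i) (R i) (H i) U) :
    B9.Cor38Printed c35 geo bg (fun i => W38OfOpsDir (𝔬 i) (𝔡 i) (𝔩 i) (rd i) (R i) (H i) C δ) := by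
  have hcpos : 0 < B₀ * Real.exp (δ₀ * ρ) * θ₀ * B6.c1 d δ₀ α + 1 := by
    have h0 : 0 ≤ B₀ * Real.exp (δ₀ * ρ) * θ₀ * B6.c1 d δ₀ α :=
      mul_nonneg (mul_nonneg (mul_nonneg hB₀.le (Real.exp_nonneg _)) hθ₀) (c1_nonneg d δ₀ α)
    linarith
  refine ⟨max M₁ ML, a₁ / c35, 2 * ((1 - α) * δ₀), B₀, B₀ * Real.exp (δ₀ * ρ) * θ₀ * B6.c1 d δ₀ α + 1,
    lt_max_of_lt_left hM₁, div_pos ha₁ hc, by nlinarith, hB₀, hcpos, ?_⟩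
  intro i hM α₀ hα₀ hMa U hU w lam y y' hfirst _hlast hlam
  have hM₁i : M₁ ≤ (geo i).M := le_trans (le_max_left _ _) hM
  have hMLi : ML ≤ (geo i).M := le_trans (le_max_right _ _) hM
  have hMpos : 0 < (geo i).M := lt_of_lt_of_le hM₁ hM₁i
  have ha : c35 * (geo i).M * α₀ ≤ a₁ := by
    have h1 : (geo i).M * α₀ * c35 ≤ a₁ := (le_div_iff₀ hc).mp hMa
    calc c35 * (geo i).M * α₀ = (geo i).M * α₀ * c35 := by ring
      _ ≤ a₁ := h1
  obtain ⟨hl, hT, hi⟩ := h36 i hM₁i α₀ hα₀ ha U hU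
  exact ⟨locDep_W38OfOpsDir (𝔬 i) (𝔡 i) (𝔩 i) (rd i) (R i) (H i) C δ (hloc i) U w,
    term_W38OfOpsDir_le (𝔬 i) (𝔡 i) (𝔩 i) (rd i) (R i) (H i) C δ d δ₀ α ρ B₀ N N' Cℓ θ₀ (κ i) U hB₀.le hδ₀.le hα hα1.le
      hθ₀ hMpos (hst i) (hκ i).nonneg (hκ i).row (h261 i hMLi) (hrd i) hl hT hi w lam y y' hfirst hlam⟩

/-- ★ **(v2.) THEOREM 3.7 AS THE WHOLE PRINTED LEAF AT THE SAME DATUM** — `B9Thm37GlueDir.thm37Printed_of_local342₂` read at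
`W38OfOpsDir` (`E37OfOps (W38OfOpsDir …) … = W38OfOpsDir …` by `rfl`): one expansion datum carries BOTH knit fields `t37` and
`c38`.  Hypotheses as there. [cite: Balaban1985BackgroundPropagators, Thm 3.7 (3.90) pp.409–410] -/
theorem thm37Printed_W38OfOps_of_local342₂ (𝔬 : ∀ i, Ops (geo i) (bg i) (X i) (Y i) (ι i)) (𝔡 : ∀ i, DirOps37 (𝔬 i) (Dir i))
    (𝔩 : ∀ i, DirLetters37 (𝔬 i) (Dir i))
    (rd : ∀ i, WalkReading (geo i) (bg i) (X i) (ι i)) (R : I → ℝ) (H : I → Prop) (κ : I → Sizes) (d : ℕ)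
    (α ρ N N' Cℓ K θ₀ B₀ δ₀ a₁ M₁ ML : ℝ)
    (hc : 0 < c35) (hα : 0 ≤ α) (hα2 : α ≤ 1 / 2) (hN : 0 ≤ N) (hN' : 0 ≤ N') (hCℓ : 1 ≤ Cℓ) (hK : 0 ≤ K)
    (hB₀ : 0 ≤ B₀) (hδ₀ : 0 ≤ δ₀) (ha₁ : 0 < a₁) (hM₁ : 0 < M₁)
    (hst : ∀ i, StaticOK (𝔬 i) ρ N N' Cℓ (κ i)) (hκ : ∀ i, (κ i).Bounded K θ₀ Cℓ (geo i).M)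
    (h261 : ∀ i, ML ≤ (geo i).M → Ineq261 d (toB6 (geo i) (R i) (H i)) δ₀ α)
    (h36 : ∀ i, M₁ ≤ (geo i).M → ∀ α₀ : ℝ, 0 < α₀ → c35 * (geo i).M * α₀ ≤ a₁ →
      ∀ U : (bg i).Cfg, (bg i).Reg335 c35 α₀ U →
        Local342 (𝔬 i) (R i) (H i) B₀ δ₀ U ∧ DirSupSq37 (𝔬 i) (𝔡 i) (R i) (H i) U ∧ Identities₂ (𝔬 i) (𝔡 i) (𝔩 i) (R i) (H i) U) :
    B9.Thm37Printed c35 geo bg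
      (fun i => W38OfOpsDir (𝔬 i) (𝔡 i) (𝔩 i) (rd i) (R i) (H i) (const37 d δ₀ α ρ B₀ N N' Cℓ K) ((1 - 2 * α) * δ₀)) :=
  thm37Printed_of_local342₂
    (fun i => W38OfOpsDir (𝔬 i) (𝔡 i) (𝔩 i) (rd i) (R i) (H i) (const37 d δ₀ α ρ B₀ N N' Cℓ K) ((1 - 2 * α) * δ₀))
    𝔬 𝔡 𝔩 R H κ d α ρ N N' Cℓ K θ₀ B₀ δ₀ a₁ M₁ ML hc hα hα2 hN hN' hCℓ hK hB₀ hδ₀ ha₁ hM₁ hst hκ h261 h36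

/-- ★ **(v2: `B9RWSums347DefiniteFaces.thm37_cor38_W38OfOps_exp261_of_rowSum261` over the direction letters.) ROWS t37 AND c38 AT ONE LITERAL DATUM, (2.61) SUPPLIED BY `RowSum261`**: Theorem 3.7 and Corollary 3.8 as the whole printed
leaves at the SAME pinned datum `W38OfOpsDir (𝔬 i) (𝔡 i) (𝔩 i) (rd i) (R i) (H i) (const37 (exp261 geo δ₀ α) …) ((1 − 2α)δ₀)`
(`thm37Printed_W38OfOps_of_local342₂` + `cor38Printed_of_local342₂`) — the knit's walk pin `(ops x).E37 = W38OfOps …`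
names the exponent and carries no (2.61) binder. [cite: Balaban1985BackgroundPropagators, Thm 3.7 (3.90) pp.409–410 + Cor. 3.8 (3.94) p.410; Balaban1984PropagatorsII, Lemma 2.1 (2.61) p.234] -/
theorem thm37_cor38_W38OfOps_exp261_of_rowSum261₂ (𝔬 : ∀ i, Ops (geo i) (bg i) (X i) (Y i) (ι i))
    (𝔡 : ∀ i, DirOps37 (𝔬 i) (Dir i)) (𝔩 : ∀ i, DirLetters37 (𝔬 i) (Dir i))
    (rd : ∀ i, WalkReading (geo i) (bg i) (X i) (ι i)) (R : I → ℝ) (H : I → Prop) (κ : I → Sizes)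
    (α ρ N N' Cℓ K θ₀ B₀ δ₀ a₁ M₁ : ℝ)
    (hc : 0 < c35) (hα : 0 < α) (hα2 : α ≤ 1 / 2) (hN : 0 ≤ N) (hN' : 0 ≤ N') (hCℓ : 1 ≤ Cℓ) (hK : 0 ≤ K)
    (hθ₀ : 0 ≤ θ₀) (hB₀ : 0 < B₀) (hδ₀ : 0 < δ₀) (ha₁ : 0 < a₁) (hM₁ : 0 < M₁)
    (hst : ∀ i, StaticOK (𝔬 i) ρ N N' Cℓ (κ i)) (hκ : ∀ i, (κ i).Bounded K θ₀ Cℓ (geo i).M)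
    (hrd : ∀ i, (rd i).OK (𝔬 i).blk) (hloc : ∀ i, LocalityDir (𝔬 i) (𝔡 i) (𝔩 i) (rd i))
    (hrow : RowSum261 geo)
    (h36 : ∀ i, M₁ ≤ (geo i).M → ∀ α₀ : ℝ, 0 < α₀ → c35 * (geo i).M * α₀ ≤ a₁ →
      ∀ U : (bg i).Cfg, (bg i).Reg335 c35 α₀ U →
        Local342 (𝔬 i) (R i) (H i) B₀ δ₀ U ∧ DirSupSq37 (𝔬 i) (𝔡 i) (R i) (H i) U ∧ Identities₂ (𝔬 i) (𝔡 i) (𝔩 i) (R i) (H i) U) :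
    B9.Thm37Printed c35 geo bg
        (fun i => W38OfOpsDir (𝔬 i) (𝔡 i) (𝔩 i) (rd i) (R i) (H i) (const37 (exp261 geo δ₀ α) δ₀ α ρ B₀ N N' Cℓ K)
          ((1 - 2 * α) * δ₀)) ∧
      B9.Cor38Printed c35 geo bg
        (fun i => W38OfOpsDir (𝔬 i) (𝔡 i) (𝔩 i) (rd i) (R i) (H i) (const37 (exp261 geo δ₀ α) δ₀ α ρ B₀ N N' Cℓ K)
          ((1 - 2 * α) * δ₀)) := by
  obtain ⟨ML, h261⟩ := ineq261_exp261_of_rowSum261 (geo := geo) R H (mul_pos hα hδ₀) hrow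
  exact ⟨thm37Printed_W38OfOps_of_local342₂ 𝔬 𝔡 𝔩 rd R H κ _ α ρ N N' Cℓ K θ₀ B₀ δ₀ a₁ M₁ ML hc hα.le hα2 hN hN' hCℓ
      hK hB₀.le hδ₀.le ha₁ hM₁ hst hκ h261 h36,
    cor38Printed_of_local342₂ 𝔬 𝔡 𝔩 rd R H κ _ _ _ α ρ N N' Cℓ K θ₀ B₀ δ₀ a₁ M₁ ML hc hα.le (by linarith) hθ₀ hB₀ hδ₀
      ha₁ hM₁ hst hκ hrd hloc h261 h36⟩

end Family

/-! ## §3 Row 13 (t37 ∧ c38) at the record geometry `geo9Y` -/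

section FacesY

variable {d ℓ : ℕ} {hd : 1 ≤ d + 1} {hL : Odd (ℓ + 1) ∧ 1 < ℓ + 1} {b₀ b₁ : ℝ} {Mstar : ℕ}
variable [∀ x : MemberY d ℓ hd hL b₀ b₁ Mstar, Fintype (geo9Y x).Site]
  [∀ x : MemberY d ℓ hd hL b₀ b₁ Mstar, DecidableEq (geo9Y x).Site]
variable {c35 : ℝ} {bg : MemberY d ℓ hd hL b₀ b₁ Mstar → B9.Backgrounds}
variable {X Y ι Dir : MemberY d ℓ hd hL b₀ b₁ Mstar → Type} [∀ x, Fintype (X x)] [∀ x, DecidableEq (X x)]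
  [∀ x, Fintype (Y x)] [∀ x, DecidableEq (Y x)] [∀ x, Fintype (ι x)] [∀ x, Fintype (Dir x)]

/-- ★ **(v2 over the direction letters.) ROW 13 (t37 ∧ c38) AT THE RECORD GEOMETRY WITH NO (2.61) BINDER**: Theorem 3.7 and Corollary 3.8 as the whole printed leaves
at the literal datum `W38OfOpsDir (𝔬 x) (𝔡 x) (𝔩 x) (rd x) (R x) (H x) (const37 (exp261 geo9Y δ₀ α) …) ((1 − 2α)δ₀)` over def-Y's members — (2.61)
from n06-i's `rowSum261_geo9Y` BY NAME. [cite: Balaban1985BackgroundPropagators, Thm 3.7 (3.90) pp.409–410 + Cor. 3.8 (3.94) p.410; Balaban1984PropagatorsII, Lemma 2.1 (2.61) p.234] -/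
theorem thm37_cor38_W38OfOps_exp261_geo9Y₂
    (𝔬 : ∀ x : MemberY d ℓ hd hL b₀ b₁ Mstar, Ops (geo9Y x) (bg x) (X x) (Y x) (ι x))
    (𝔡 : ∀ x : MemberY d ℓ hd hL b₀ b₁ Mstar, DirOps37 (𝔬 x) (Dir x)) (𝔩 : ∀ x : MemberY d ℓ hd hL b₀ b₁ Mstar, DirLetters37 (𝔬 x) (Dir x))
    (rd : ∀ x : MemberY d ℓ hd hL b₀ b₁ Mstar, WalkReading (geo9Y x) (bg x) (X x) (ι x))
    (R : MemberY d ℓ hd hL b₀ b₁ Mstar → ℝ) (H : MemberY d ℓ hd hL b₀ b₁ Mstar → Prop)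
    (κ : MemberY d ℓ hd hL b₀ b₁ Mstar → Sizes) (α ρ N N' Cℓ K θ₀ B₀ δ₀ a₁ M₁ : ℝ)
    (hc : 0 < c35) (hα : 0 < α) (hα2 : α ≤ 1 / 2) (hN : 0 ≤ N) (hN' : 0 ≤ N') (hCℓ : 1 ≤ Cℓ) (hK : 0 ≤ K)
    (hθ₀ : 0 ≤ θ₀) (hB₀ : 0 < B₀) (hδ₀ : 0 < δ₀) (ha₁ : 0 < a₁) (hM₁ : 0 < M₁)
    (hst : ∀ x, StaticOK (𝔬 x) ρ N N' Cℓ (κ x)) (hκ : ∀ x, (κ x).Bounded K θ₀ Cℓ (geo9Y x).M)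
    (hrd : ∀ x, (rd x).OK (𝔬 x).blk) (hloc : ∀ x, LocalityDir (𝔬 x) (𝔡 x) (𝔩 x) (rd x))
    (h36 : ∀ x, M₁ ≤ (geo9Y x).M → ∀ α₀ : ℝ, 0 < α₀ → c35 * (geo9Y x).M * α₀ ≤ a₁ →
      ∀ U : (bg x).Cfg, (bg x).Reg335 c35 α₀ U →
        Local342 (𝔬 x) (R x) (H x) B₀ δ₀ U ∧ DirSupSq37 (𝔬 x) (𝔡 x) (R x) (H x) U ∧ Identities₂ (𝔬 x) (𝔡 x) (𝔩 x) (R x) (H x) U) :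
    B9.Thm37Printed c35 geo9Y bg
        (fun x => W38OfOpsDir (𝔬 x) (𝔡 x) (𝔩 x) (rd x) (R x) (H x)
          (const37 (exp261 (@geo9Y d ℓ hd hL b₀ b₁ Mstar) δ₀ α) δ₀ α ρ B₀ N N' Cℓ K) ((1 - 2 * α) * δ₀)) ∧
      B9.Cor38Printed c35 geo9Y bg
        (fun x => W38OfOpsDir (𝔬 x) (𝔡 x) (𝔩 x) (rd x) (R x) (H x)
          (const37 (exp261 (@geo9Y d ℓ hd hL b₀ b₁ Mstar) δ₀ α) δ₀ α ρ B₀ N N' Cℓ K) ((1 - 2 * α) * δ₀)) :=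
  thm37_cor38_W38OfOps_exp261_of_rowSum261₂ 𝔬 𝔡 𝔩 rd R H κ α ρ N N' Cℓ K θ₀ B₀ δ₀ a₁ M₁ hc hα hα2 hN hN' hCℓ hK hθ₀ hB₀
    hδ₀ ha₁ hM₁ hst hκ hrd hloc rowSum261_geo9Y h36

end FacesY

end

end Literature.MathematicalPhysics.QuantumFieldTheory.Balaban1983to89.B9Cor38WholeDir
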